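/-
Origin: expansion seat `planner-pub-hodgecm-pv01-g5-0`, handover pv01-g5 ; 2026-08-18T13:46:05Z (`HOME/pub-hodgecm-pv01-g5/lean/Pv01g5/EndStateNormalised.lean`, md5 bbf55ac9, 219 lines);
landed by the gen-8 packager in gate run 30 as `HodgeCM/PerL34/EndStateNormalised.lean` (verbatim).
-/
/-
Copyright: pub-hodgecm formalisation cell (harness21, 2026). New file (not vendored).
Origin: HOME/pub-hodgecm-pv01-g5/lean/Pv01g5/EndStateNormalised.lean — session planner-pub-hodgecm-pv01-g5-0 (unit
pub-hodgecm-pv01-g5, DAG-NODE PROVER #01, generation 5), eighth file.  WIP module `Pv01g5.EndStateNormalised`; intended final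
place `HodgeCM/PerL34/EndStateNormalised.lean` (module `HodgeCM.PerL34.EndStateNormalised`).  ADDITIVE LEAF: replaces nothing,
nothing imports it.  Imports are TREE names only, both landed in gate run 29: `HodgeCM.Automorphic.SignRecipeEndStateAllChars`
(prl1-g6) and `HodgeCM.PerL34.EndStateMinimal` (this seat) — NO import rewrite.
-/
import Summits.HodgeConjecture.HodgeCM.Automorphic.SignRecipeEndStateAllChars_2
import Summits.HodgeConjecture.HodgeCM.PerL34.EndStateMinimal

/-!
# The PerL END STATE over the NORMALISED theta model `T.allChars.withSignRecipe h`: `hch` AND `h12b` by construction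

prl1-g6's `ThetaModel.allChars` (run 29) allows every character of type `w` / `w'` on both torus sides and proves
`allChars_chars : T.allChars.Open_chars` by `trivial`; prl1-g5's `ThetaModel.withSignRecipe h` (run 27) re-signs a model
to print's sign recipe and proves `N12b_signRecipe_withSignRecipe`.  Over the NORMALISED model

  `T° := T.allChars.withSignRecipe h`   (`= (T.withSignRecipe h).allChars`, `normalised_comm`, by `rfl`)

TWO of the thirteen non-`M` binders of `AssemblyRoutes.perL_of_openCharsWeilLeavesCRΔ` are theorems: `h12b`
(`N12b_signRecipe T°`, `n12b_normalised`) and `hch` (`T°.Open_chars`, `chars_normalised`).  This file records the end state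
over `T°`:

* `HeadlineBundle6 T Pc` — pv01-g4's `EndStateCensus.HeadlineBundle` without its `chars` field (six open/record binders:
  alb, bridges, qaut, arch12, arch34, weil), and `headlineBundle_iff_six_of_chars (hch) : HeadlineBundle T Pc ↔
  HeadlineBundle6 T Pc` for any model whose `Open_chars` holds;
* `endState_normalised_iff : EndState T° Pc ↔ EndStatePrints4 T ∧ HeadlineBundle6 T° Pc` — the end state over a
  normalised model is worth the FOUR facts of `T` (three P-anchored print facts N07, N09a, N09b + the class-M model fact
  M38) and SIX binders;
* `perL_of_weilLeavesCRΔ_normalised` — `U.PerL` from `M` + ELEVEN PerL-side binders (binders explicit, audited-list form);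
* `hcCM_of_weilLeavesCRΔ_normalised_descentFactsB₄` — `U.HC_CM` from `M` + 11 + the seven [QW8]-side facts of route (δ)
  (`EndStateMinimal`'s `M` + 12 + 7 with `hch` gone): **`M` + 11 + 7**;
* `endToEnd_normalisedB₄` — every conclusion of record (`HC_CM`, `PerL44`, `PerL`, face F, `W_RK4`) from `M`, the four
  facts, `HeadlineBundle6 T° Pc` and the seven route-(δ) facts.

HONEST READING (binding; carver LEMMAS v22 row N34, adv2 C71 / referee A G33 fidelity clause): the count drops 13 → 11,
the CONTENT does not.  Re-signing changes exactly the guard `GoodCtx` of the open binders (`EndStateSignRecipe`); passing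
to `allChars` RE-PACKAGES the per-character residual of N31 = PerL L4.2(b) into the torus-side leaves — over `T.allChars`
the (12)/(34) theta inputs inside `hW` / `DictLeaves` read `Open_thetaGen12All` / `Open_thetaReal34All` (prl1-g6
`allChars_thetaGen12_iff`, `allChars_thetaReal34_iff`: N19w into `S₁₂^all`, N19g for EVERY character of type `w'`), which are
implied by, and under `Open_chars` equivalent to, the inputs of record (`thetaGen12All_of`, `thetaReal34All_iff_of_chars`).
Nothing is discharged from print; no binder of the six got smaller.  Nothing cited, nothing posited; Mathlib + the package
only.
-/

set_option autoImplicit false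

noncomputable section

open HodgeCM.Prior.Perl34File HodgeCM.Prior.Perl34File.Perl34 HodgeCM.PerL34.ArchC

namespace HodgeCM

namespace PerL34

namespace EndStateNormalised

open Universe Universe.ThetaModel AssemblyRoutes EndStateShadow EndStateCensus EndStateLinks CharSpansFinal
  EndStateSignRecipe

variable {U : Universe} (T : U.ThetaModel) (h : Bool)

/-! ## The normalised model and its two theorem-binders -/

/-- The two normalisations commute on the nose: all characters then re-sign = re-sign then all characters. -/
theorem normalised_comm : T.allChars.withSignRecipe h = (T.withSignRecipe h).allChars := rfl

/-- `h12b` over the normalised model is a theorem (prl1-g5). -/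
theorem n12b_normalised : N12b_signRecipe (T.allChars.withSignRecipe h) :=
  N12b_signRecipe_withSignRecipe T.allChars h

/-- `hch` over the normalised model is a theorem (prl1-g6 `allChars_chars`, transported along `normalised_comm`). -/
theorem chars_normalised : (T.allChars.withSignRecipe h).Open_chars :=
  allChars_chars (T.withSignRecipe h)

/-- (Ported verbatim from the HodgeCMPerL package; no docstring in the source.) -/
theorem N09a_allChars_iff : N09a_embCover T.allChars ↔ N09a_embCover T := Iff.rfl

/-- (Ported verbatim from the HodgeCMPerL package; no docstring in the source.) -/
theorem N09b_allChars_iff : N09b_innerEmb T.allChars ↔ N09b_innerEmb T := Iff.rfl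

/-- (Ported verbatim from the HodgeCMPerL package; no docstring in the source.) -/
theorem N12b_allChars_iff : N12b_signRecipe T.allChars ↔ N12b_signRecipe T := Iff.rfl

/-- (Ported verbatim from the HodgeCMPerL package; no docstring in the source.) -/
theorem fact_coverTheta_allChars_iff : T.allChars.Fact_coverTheta ↔ T.Fact_coverTheta := Iff.rfl

/-- The four facts (3 P + M38) do not see `allChars`. -/
theorem endStatePrints4_allChars_iff : EndStatePrints4 T.allChars ↔ EndStatePrints4 T :=
  ⟨fun P => ⟨P.h07, P.h09a, P.h09b, P.hM38⟩, fun P => ⟨P.h07, P.h09a, P.h09b, P.hM38⟩⟩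

/-! ## The headline bundle without `chars` -/

/-- pv01-g4's `EndStateCensus.HeadlineBundle T Pc` WITHOUT its `chars` field: the six open / record binders `hAlb`
(S6), `hbr`, `hQ` (S5), `A12`, `A34` (S4), `hW` (S1/S2). -/
structure HeadlineBundle6
    (Pc : ∀ {L : CMField} {ι₁ : L →+* ℂ} (V : HermSpace3 L ι₁) (c : SeesawCtx L),
      C4a.PointedCore (T.core V c)) : Prop where
  alb : T.Fact_thetaAlbanese
  bridges : ∀ {L : CMField} {ι₁ : L →+* ℂ} (V : HermSpace3 L ι₁) (c : SeesawCtx L), T.GoodCtx ι₁ c →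
    Nonempty (SeesawDictionary.SeesawBridge T V c (T.t12 V c) 0 1)
  qaut : ∀ {L : CMField} {ι₁ : L →+* ℂ} (V : HermSpace3 L ι₁) (c : SeesawCtx L), T.GoodCtx ι₁ c →
    Nonempty (QautDictionary.QautBridge T V c (T.t34 V c) 2 3)
  arch12 : ∀ {L : CMField} {ι₁ : L →+* ℂ} (V : HermSpace3 L ι₁) (c : SeesawCtx L), T.GoodCtx ι₁ c →
    Nonempty (ArchCDatum (T.core V c) (T.t12 V c) (Pc V c))
  arch34 : ∀ {L : CMField} {ι₁ : L →+* ℂ} (V : HermSpace3 L ι₁) (c : SeesawCtx L), T.GoodCtx ι₁ c →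
    Nonempty (ArchCDatum (T.core V c) (T.t34 V c) (Pc V c))
  weil : WeilStepsInputCRΔ T

variable {T}
variable {Pc : ∀ {L : CMField} {ι₁ : L →+* ℂ} (V : HermSpace3 L ι₁) (c : SeesawCtx L),
  C4a.PointedCore (T.core V c)}

/-- For a model whose `Open_chars` holds, the headline bundle is its six other fields. -/
theorem headlineBundle_iff_six_of_chars (hch : T.Open_chars) : HeadlineBundle T Pc ↔ HeadlineBundle6 T Pc :=
  ⟨fun B => ⟨B.alb, B.bridges, B.qaut, B.arch12, B.arch34, B.weil⟩,
    fun B => ⟨B.alb, B.bridges, B.qaut, B.arch12, B.arch34, hch, B.weil⟩⟩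

/-! ## The end state over the normalised model -/

/-- **EXACT WORTH of the end state over the normalised model `T.allChars.withSignRecipe h`**: the FOUR facts of `T`
(3 P-anchored print facts + class-M M38) and the SIX binders of `HeadlineBundle6` — `h12b` and `hch` are theorems. -/
theorem endState_normalised_iff :
    EndState (T.allChars.withSignRecipe h) Pc ↔
      EndStatePrints4 T ∧ HeadlineBundle6 (T.allChars.withSignRecipe h) Pc :=
  (endState_withSignRecipe_iff_headlineBundle (T := T.allChars) (Pc := Pc) h).trans
    (and_congr (endStatePrints4_allChars_iff T) (headlineBundle_iff_six_of_chars (chars_normalised T h)))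

/-- The end state over the normalised model from the four facts and the six binders. -/
theorem endState_normalised_of (P : EndStatePrints4 T) (B : HeadlineBundle6 (T.allChars.withSignRecipe h) Pc) :
    EndState (T.allChars.withSignRecipe h) Pc :=
  (endState_normalised_iff h).2 ⟨P, B⟩

/-- **Every conclusion of record, `M` + 4 facts + 6 binders + 7 route-(δ) facts**: `HC_CM`, `PerL44`, `PerL`, the period
theorem face F, `W_RK4` (= `EndStateHCCM.endToEndB₄` at `endState_normalised_of`). -/
theorem endToEnd_normalisedB₄ (M : U.ModelAxioms) (P : EndStatePrints4 T)
    (B : HeadlineBundle6 (T.allChars.withSignRecipe h) Pc)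
    (hN1 : U.Fact_cupExterior) (hN2 : U.Fact_cup_hodge) (h4 : U.Fact_cupAlg) (h5 : U.Fact_cupAssoc)
    (hu : U.Fact_unitH0) (hb : U.Fact_gysinDescentB) (hd : U.Fact_dimProd) :
    U.HC_CM ∧ U.PerL44 ∧ U.PerL ∧ U.PeriodThmF ∧ U.W_RK4 :=
  EndStateHCCM.endToEndB₄ M (endState_normalised_of h P B) hN1 hN2 h4 h5 hu hb hd

/-- `U.PerL` from `M`, the four facts and the six binders of the normalised model. -/
theorem perL_of_prints4_six (M : U.ModelAxioms) (P : EndStatePrints4 T)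
    (B : HeadlineBundle6 (T.allChars.withSignRecipe h) Pc) : U.PerL :=
  (endState_normalised_of (Pc := Pc) h P B).perL M

end EndStateNormalised

open EndStateNormalised in
/-- **`U.PerL` from `M` + ELEVEN PerL-side binders** (audited-list form): the model axioms `M`; the convention bit `h`; over
the normalised model `T° := T.allChars.withSignRecipe h` the binders of `AssemblyRoutes.perL_of_openCharsWeilLeavesCRΔ` in
its order and with its types, `h12b` AND `hch` OMITTED (both theorems over `T°`: `n12b_normalised`, `chars_normalised`);
N09a/N09b stated for `T` (literally the same propositions).  HONEST READING: see the module docstring — 13 → 11 is a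
re-packaging (guard `GoodCtx` re-signed; N31's per-character residual moved into the torus-side leaves of `hW`), not a
discharge. -/
theorem perL_of_weilLeavesCRΔ_normalised {U : Universe} (M : U.ModelAxioms) (T : U.ThetaModel) (h : Bool)
    (h07 : N07_hodgeRiemann20 U) (h09a : N09a_embCover T) (h09b : N09b_innerEmb T)
    (hM38 : U.Fact_cmInflation) (hAlb : (T.allChars.withSignRecipe h).Fact_thetaAlbanese)
    (hbr : ∀ {L : CMField} {ι₁ : L →+* ℂ} (V : HermSpace3 L ι₁) (c : SeesawCtx L),
      (T.allChars.withSignRecipe h).GoodCtx ι₁ c →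
        Nonempty (SeesawDictionary.SeesawBridge (T.allChars.withSignRecipe h) V c
          ((T.allChars.withSignRecipe h).t12 V c) 0 1))
    (hQ : ∀ {L : CMField} {ι₁ : L →+* ℂ} (V : HermSpace3 L ι₁) (c : SeesawCtx L),
      (T.allChars.withSignRecipe h).GoodCtx ι₁ c →
        Nonempty (QautDictionary.QautBridge (T.allChars.withSignRecipe h) V c
          ((T.allChars.withSignRecipe h).t34 V c) 2 3))
    (Pc : ∀ {L : CMField} {ι₁ : L →+* ℂ} (V : HermSpace3 L ι₁) (c : SeesawCtx L),
      C4a.PointedCore ((T.allChars.withSignRecipe h).core V c))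
    (A12 : ∀ {L : CMField} {ι₁ : L →+* ℂ} (V : HermSpace3 L ι₁) (c : SeesawCtx L),
      (T.allChars.withSignRecipe h).GoodCtx ι₁ c →
        Nonempty (ArchCDatum ((T.allChars.withSignRecipe h).core V c) ((T.allChars.withSignRecipe h).t12 V c)
          (Pc V c)))
    (A34 : ∀ {L : CMField} {ι₁ : L →+* ℂ} (V : HermSpace3 L ι₁) (c : SeesawCtx L),
      (T.allChars.withSignRecipe h).GoodCtx ι₁ c →
        Nonempty (ArchCDatum ((T.allChars.withSignRecipe h).core V c) ((T.allChars.withSignRecipe h).t34 V c)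
          (Pc V c)))
    (hW : CharSpansFinal.WeilStepsInputCRΔ (T.allChars.withSignRecipe h)) : U.PerL :=
  EndStateSignRecipe.perL_of_openCharsWeilLeavesCRΔ_signRecipe M T.allChars h h07
    ((N09a_allChars_iff T).2 h09a) ((N09b_allChars_iff T).2 h09b) hM38 hAlb hbr hQ Pc A12 A34
    (chars_normalised T h) hW

open EndStateNormalised in
/-- **`HC_CM` END TO END, `M` + 11 + 7** (audited-list form): `M`; the bit `h`; the eleven PerL-side binders over the
normalised model `T.allChars.withSignRecipe h` (as in `perL_of_weilLeavesCRΔ_normalised`); the seven [QW8]-side facts of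
route (δ) N1, N2, F4, F5, F-H0, F7d-B, M40 (no N3, no N4).  Conclusion `U.HC_CM`.  Compare `EndStateMinimal`'s
`hcCM_of_openCharsWeilLeavesCRΔ_signRecipe_descentFactsB₄` (`M` + 12 + 7) and the run-26 original (`M` + 13 + 8).  HONEST
READING as in the module docstring. -/
theorem hcCM_of_weilLeavesCRΔ_normalised_descentFactsB₄ {U : Universe} (M : U.ModelAxioms) (T : U.ThetaModel)
    (h : Bool)
    (h07 : N07_hodgeRiemann20 U) (h09a : N09a_embCover T) (h09b : N09b_innerEmb T)
    (hM38 : U.Fact_cmInflation) (hAlb : (T.allChars.withSignRecipe h).Fact_thetaAlbanese)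
    (hbr : ∀ {L : CMField} {ι₁ : L →+* ℂ} (V : HermSpace3 L ι₁) (c : SeesawCtx L),
      (T.allChars.withSignRecipe h).GoodCtx ι₁ c →
        Nonempty (SeesawDictionary.SeesawBridge (T.allChars.withSignRecipe h) V c
          ((T.allChars.withSignRecipe h).t12 V c) 0 1))
    (hQ : ∀ {L : CMField} {ι₁ : L →+* ℂ} (V : HermSpace3 L ι₁) (c : SeesawCtx L),
      (T.allChars.withSignRecipe h).GoodCtx ι₁ c →
        Nonempty (QautDictionary.QautBridge (T.allChars.withSignRecipe h) V c
          ((T.allChars.withSignRecipe h).t34 V c) 2 3))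
    (Pc : ∀ {L : CMField} {ι₁ : L →+* ℂ} (V : HermSpace3 L ι₁) (c : SeesawCtx L),
      C4a.PointedCore ((T.allChars.withSignRecipe h).core V c))
    (A12 : ∀ {L : CMField} {ι₁ : L →+* ℂ} (V : HermSpace3 L ι₁) (c : SeesawCtx L),
      (T.allChars.withSignRecipe h).GoodCtx ι₁ c →
        Nonempty (ArchCDatum ((T.allChars.withSignRecipe h).core V c) ((T.allChars.withSignRecipe h).t12 V c)
          (Pc V c)))
    (A34 : ∀ {L : CMField} {ι₁ : L →+* ℂ} (V : HermSpace3 L ι₁) (c : SeesawCtx L),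
      (T.allChars.withSignRecipe h).GoodCtx ι₁ c →
        Nonempty (ArchCDatum ((T.allChars.withSignRecipe h).core V c) ((T.allChars.withSignRecipe h).t34 V c)
          (Pc V c)))
    (hW : CharSpansFinal.WeilStepsInputCRΔ (T.allChars.withSignRecipe h))
    (hN1 : U.Fact_cupExterior) (hN2 : U.Fact_cup_hodge) (h4 : U.Fact_cupAlg) (h5 : U.Fact_cupAssoc)
    (hu : U.Fact_unitH0) (hb : U.Fact_gysinDescentB) (hd : U.Fact_dimProd) : U.HC_CM :=
  HodgeCM.PerL34.hcCM_of_openCharsWeilLeavesCRΔ_signRecipe_descentFactsB₄ M T.allChars h h07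
    ((N09a_allChars_iff T).2 h09a) ((N09b_allChars_iff T).2 h09b) hM38 hAlb hbr hQ Pc A12 A34
    (chars_normalised T h) hW hN1 hN2 h4 h5 hu hb hd

end PerL34

end HodgeCM

end
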